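import Mathlib
import Literature.Probability.Percolation.Percolation
import Literature.Probability.Percolation.DiagonalStripColumns
import Literature.Probability.Percolation.DiagonalColumnPatterns
import Literature.Probability.Percolation.DiagonalStripTransferExplicit
import Literature.Probability.Percolation.DiagonalStripTransferInhomogeneous
import Literature.Probability.Percolation.DiagonalStripTLAction
import Literature.Probability.Percolation.DiagonalStripTLActionFork
import Literature.Probability.Percolation.DiagonalStripTransferInterlacing
import Literature.Probability.Percolation.DiagonalStripLumping
import Literature.Probability.LatticeModels.TemperleyLiebBaxterization
import HarnessLib

/-!
# Ikhlef–Ponsaing's Lemma 3.2: the interlacing relation of `t(w; z⃗)` (cluster language)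

Topic `Literature/Probability/Percolation`. Ikhlef–Ponsaing (J. Stat. Phys. 149 (2012),
arXiv:1202.5476) Lemma 3.2: the inhomogeneous double-row transfer matrix satisfies
`t(w; …, z_i, z_{i+1}, …) Ř_i(z_i/z_{i+1}) = Ř_i(z_i/z_{i+1}) t(w; …, z_{i+1}, z_i, …)`-type
interlacing with `Ř_i(x) = ([q/x] - [x] e_i)/[qx]`. Here `t = ipTransferMatrixW m q w z`
(`DiagonalStripTransferInhomogeneous.lean`, a kernel on column patterns lumped at the even column)
and `e_i` acts on the connectivity states by `join_{j,j+1}` (`i = 2j+1`) / `iso_b` (`i = 2b`)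
(`cpJoin` / `cpIsolate`). In kernel (matrix) form, `Ř_i(x) T(z⃗) = T(s_i z⃗) Ř_i(x)` with
`T[Q''][Q] = t(Q → Q'')` reads
`[q/x] t_z(Q → Q'') - [x] Σ_{Q' : e_i Q' ≡ Q''} t_z(Q → Q') = [q/x] t_{s_i z}(Q → Q'') - [x] t_{s_i z}(e_i Q → Q'')`
(`x = z_i/z_{i+1}`, `≡` up to lumping), and this is what is proved:
**`ipTransferMatrixW_interlace_odd`**, **`ipTransferMatrixW_interlace_even`**, for generic
parameters (`q² + q + 1 = 0`; `w, z_i, z_{i+1} ≠ 0`; `[qw/z_i], [qw/z_{i+1}], [qwz_i], [qwz_{i+1}] ≠ 0`)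
and valid input patterns `Q`.

Proof (IP12: "thanks to the YBE"): each row interlaces by the single-row identities of
`DiagonalStripTransferInterlacing.lean` (the TL generator acting as `iso`/`join` on the three
columns according to the parity tables of the levels), the two rows compose (`interlace_compose`),
and lumping at the even column commutes with the moves (`lump_cpIsolate`, `lump_cpJoin_lump`);
the tile weights enter only through `A + B = 1` (swap-and-complement, `ipRowWeight_zswap_level`)
and the exchange identity (`ipWt_exchange_formI/II`).

Not here: the boundary reflections `z_1 → 1/z_1`, `z_L → 1/z_L` of Lemma 3.2 and `[t(w), t(w')] = 0`.

## References

* Y. Ikhlef, A. K. Ponsaing, J. Stat. Phys. 149 (2012) 10–36, arXiv:1202.5476, §2.2, Def. 3.3,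
  Lemma 3.2. [IkhlefPonsaing2012]
-/

namespace Literature.Probability.Percolation

open Literature.Probability.LatticeModels Literature.Probability.LatticeModels.TemperleyLieb

variable {m : ℕ}

/-! ### Composing two interlacing rows -/

section Compose

variable {K : Type*} [Field K] {S : Type*} [Fintype S] [DecidableEq S]

/-- **Two interlacing rows compose** (`R₂ M_B M_A = M_{B'} M_{A'} R₀` from `R₁ M_A = M_{A'} R₀` and
`R₂ M_B = M_{B'} R₁`), in kernel form: if the first row satisfies the `R`-form identity at the input
`P` and the second row satisfies it at every pattern the first row can reach from `P`, the two-row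
kernel satisfies it at `P`. [cite: IkhlefPonsaing2012, Lemma 3.2] -/
theorem interlace_compose {A A' B B' : S → S → K} {g₀ g₁ g₂ : S → S} {α β : K} {V₁ : S → Prop}
    {P : S} (hA : ∀ P₁, A P P₁ ≠ 0 → V₁ P₁)
    (h0 : ∀ P'', α * A P P'' - β * ∑ P' ∈ Finset.univ.filter (fun P' => g₁ P' = P''), A P P' =
      α * A' P P'' - β * A' (g₀ P) P'')
    (h1 : ∀ P₁, V₁ P₁ → ∀ P'', α * B P₁ P'' - β * ∑ P' ∈ Finset.univ.filter (fun P' => g₂ P' = P''), B P₁ P' =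
      α * B' P₁ P'' - β * B' (g₁ P₁) P'') (P'' : S) :
    α * (∑ P₁, A P P₁ * B P₁ P'') -
        β * ∑ P' ∈ Finset.univ.filter (fun P' => g₂ P' = P''), ∑ P₁, A P P₁ * B P₁ P' =
      α * (∑ P₁, A' P P₁ * B' P₁ P'') - β * ∑ P₁, A' (g₀ P) P₁ * B' P₁ P'' := by
  -- push the second-row identity through
  have step1 : α * (∑ P₁, A P P₁ * B P₁ P'') -
      β * ∑ P' ∈ Finset.univ.filter (fun P' => g₂ P' = P''), ∑ P₁, A P P₁ * B P₁ P' =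
      α * (∑ P₁, A P P₁ * B' P₁ P'') - β * ∑ P₁, A P P₁ * B' (g₁ P₁) P'' := by
    rw [Finset.sum_comm, Finset.mul_sum, Finset.mul_sum, Finset.mul_sum, Finset.mul_sum,
      ← Finset.sum_sub_distrib, ← Finset.sum_sub_distrib]
    refine Finset.sum_congr rfl fun P₁ _ => ?_
    by_cases hz : A P P₁ = 0
    · simp [hz]
    · have := h1 P₁ (hA P₁ hz) P''
      rw [← Finset.mul_sum]
      linear_combination (A P P₁) * this
  -- regroup the last sum along the fibres of `g₁` and use the first-row identity
  have step2 : β * ∑ P₁, A P P₁ * B' (g₁ P₁) P'' =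
      ∑ P₁', (α * A P P₁' - α * A' P P₁' + β * A' (g₀ P) P₁') * B' P₁' P'' := by
    rw [Finset.mul_sum,
      ← Finset.sum_fiberwise Finset.univ g₁ (fun P₁ => β * (A P P₁ * B' (g₁ P₁) P''))]
    refine Finset.sum_congr rfl fun P₁' _ => ?_
    have hfib : ∑ P₁ ∈ Finset.univ.filter (fun P₁ => g₁ P₁ = P₁'), β * (A P P₁ * B' (g₁ P₁) P'') =
        (β * ∑ P₁ ∈ Finset.univ.filter (fun P₁ => g₁ P₁ = P₁'), A P P₁) * B' P₁' P'' := by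
      rw [Finset.mul_sum, Finset.sum_mul]
      refine Finset.sum_congr rfl fun P₁ hP₁ => ?_
      rw [(Finset.mem_filter.1 hP₁).2]; ring
    rw [hfib]
    have := h0 P₁'
    congr 1
    linear_combination -this
  rw [step1, step2, Finset.mul_sum, Finset.mul_sum, Finset.mul_sum, ← Finset.sum_sub_distrib,
    ← Finset.sum_sub_distrib]
  refine Finset.sum_congr rfl fun P₁ _ => ?_
  ring

end Compose

/-! ### Lumping commutes with the Temperley–Lieb moves -/

section LumpTL

/-- **`lump ∘ iso_b = iso_b ∘ lump`.** [folklore] -/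
theorem lump_cpIsolate (b : Fin (m + 1)) (P : ColPattern m) : lump (cpIsolate b P) = cpIsolate b (lump P) := by
  refine Prod.ext (funext fun i => funext fun j => ?_) (funext fun i => ?_)
  · rw [Bool.eq_iff_iff, lump_fst_eq_true_iff, cpIsolate_fst_eq_true_iff, cpIsolate_fst_eq_true_iff,
      cpIsolate_snd_eq_true_iff, cpIsolate_snd_eq_true_iff, lump_fst_eq_true_iff]
    tauto
  · rw [Bool.eq_iff_iff]
    simp only [lump_snd]
    rw [cpIsolate_snd_eq_true_iff, cpIsolate_snd_eq_true_iff, lump_snd]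

/-- **`lump ∘ join_{ab} ∘ lump = lump ∘ join_{ab}`** for patterns with a symmetric relation: joining
commutes with lumping up to lumping. [folklore] -/
theorem lump_cpJoin_lump (a b : Fin (m + 1)) {P : ColPattern m} (hs : ∀ i j, P.1 i j = true → P.1 j i = true) :
    lump (cpJoin a b (lump P)) = lump (cpJoin a b P) := by
  -- the flags agree
  have hflag : ∀ x, (cpJoin a b (lump P)).2 x = true ↔ (cpJoin a b P).2 x = true := by
    intro x
    rw [cpJoin_snd_eq_true_iff, cpJoin_snd_eq_true_iff, lump_snd, lump_fst_eq_true_iff, lump_fst_eq_true_iff]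
    constructor
    · rintro (h | ⟨h1 | ⟨h1, -⟩, h2⟩ | ⟨h1 | ⟨h1, -⟩, h2⟩)
      · exact Or.inl h
      · exact Or.inr (Or.inl ⟨h1, h2⟩)
      · exact Or.inl h1
      · exact Or.inr (Or.inr ⟨h1, h2⟩)
      · exact Or.inl h1
    · rintro (h | ⟨h1, h2⟩ | ⟨h1, h2⟩)
      · exact Or.inl h
      · exact Or.inr (Or.inl ⟨Or.inl h1, h2⟩)
      · exact Or.inr (Or.inr ⟨Or.inl h1, h2⟩)
  have hflag' : (cpJoin a b (lump P)).2 = (cpJoin a b P).2 :=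
    funext fun x => Bool.eq_iff_iff.2 (hflag x)
  refine Prod.ext (funext fun x => funext fun y => ?_) ?_
  · rw [Bool.eq_iff_iff, lump_fst_eq_true_iff, lump_fst_eq_true_iff, hflag, hflag, cpJoin_fst_eq_true_iff,
      cpJoin_fst_eq_true_iff, lump_fst_eq_true_iff, lump_fst_eq_true_iff, lump_fst_eq_true_iff,
      lump_fst_eq_true_iff, lump_fst_eq_true_iff]
    have W : ∀ z, P.2 z = true → (cpJoin a b P).2 z = true := fun z hz => by
      rw [cpJoin_snd_eq_true_iff]; exact Or.inl hz
    have Wa : ∀ z, P.1 z a = true → P.2 b = true → (cpJoin a b P).2 z = true := fun z h1 h2 => by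
      rw [cpJoin_snd_eq_true_iff]; exact Or.inr (Or.inl ⟨h1, h2⟩)
    have Wb : ∀ z, P.1 z b = true → P.2 a = true → (cpJoin a b P).2 z = true := fun z h1 h2 => by
      rw [cpJoin_snd_eq_true_iff]; exact Or.inr (Or.inr ⟨h1, h2⟩)
    constructor
    · rintro (((hxy | ⟨hx, hy⟩) | ⟨hxa | ⟨hx, ha⟩, hby | ⟨hb, hy⟩⟩ | ⟨hxb | ⟨hx, hb⟩, hay | ⟨ha, hy⟩⟩) | hW)
      · exact Or.inl (Or.inl hxy)
      · exact Or.inr ⟨W x hx, W y hy⟩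
      · exact Or.inl (Or.inr (Or.inl ⟨hxa, hby⟩))
      · exact Or.inr ⟨Wa x hxa hb, W y hy⟩
      · exact Or.inr ⟨W x hx, Wb y (hs _ _ hby) ha⟩
      · exact Or.inr ⟨W x hx, W y hy⟩
      · exact Or.inl (Or.inr (Or.inr ⟨hxb, hay⟩))
      · exact Or.inr ⟨Wb x hxb ha, W y hy⟩
      · exact Or.inr ⟨W x hx, Wa y (hs _ _ hay) hb⟩
      · exact Or.inr ⟨W x hx, W y hy⟩
      · exact Or.inr hW
    · rintro ((hxy | ⟨hxa, hby⟩ | ⟨hxb, hay⟩) | hW)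
      · exact Or.inl (Or.inl (Or.inl hxy))
      · exact Or.inl (Or.inr (Or.inl ⟨Or.inl hxa, Or.inl hby⟩))
      · exact Or.inl (Or.inr (Or.inr ⟨Or.inl hxb, Or.inl hay⟩))
      · exact Or.inr hW
  · simp only [lump_snd]
    exact hflag'

end LumpTL

/-! ### Levels, lattice edges and IP12's row weights -/

section Levels

variable {K : Type*} [Field K]

/-- Which index pairs are lattice edges of the layer `c`. [cite: IkhlefPonsaing2012, §2.2] -/
theorem mk_mem_latticeLayer_iff (c : ℤ) (i j : Fin (m + 1)) :
    s(colSite c i, colSite (c + 1) j) ∈ latticeLayer m c ↔ (j : ℤ) = i ∨ (i : ℤ) - j = 1 - 2 * (c % 2) := by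
  unfold latticeLayer
  rw [Finset.mem_filter, SimpleGraph.mem_edgeSet, adj_colSite_colSite_succ_iff]
  exact ⟨fun h => h.2, fun h => ⟨mk_mem_layerPairs m c i j, h⟩⟩

/-- The top level of the edge between `colSite c i` and `colSite (c+1) j`. [folklore] -/
theorem edgeTopLevel_mk_colSite (c : ℤ) (i j : ℕ) :
    edgeTopLevel s(colSite c i, colSite (c + 1) j) = max (2 * i + c % 2) (2 * j + (c + 1) % 2) := by
  rw [edgeTopLevel_mk, colSite_add, colSite_add]

/-- **Distinct lattice edges of a layer have distinct top levels** (the tiles of a row are indexed by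
the levels `1, …, 2m+1`). [cite: IkhlefPonsaing2012, §2.2] -/
theorem eq_of_edgeTopLevel_eq {c : ℤ} {e e' : Sym2 (Site 2)} (he : e ∈ latticeLayer m c)
    (he' : e' ∈ latticeLayer m c) (h : edgeTopLevel e = edgeTopLevel e') : e = e' := by
  rw [latticeLayer_eq_image, Finset.mem_image] at he he'
  obtain ⟨p, hp, rfl⟩ := he
  obtain ⟨p', hp', rfl⟩ := he'
  simp only [latticeIdx, Finset.mem_filter, Finset.mem_univ, true_and] at hp hp'
  rw [edgeTopLevel_mk_colSite, edgeTopLevel_mk_colSite] at h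
  have hc := Int.emod_two_eq_zero_or_one c
  have h1 : (p.1 : ℕ) = p'.1 := by omega
  have h2 : (p.2 : ℕ) = p'.2 := by omega
  rw [show p = p' from Prod.ext (Fin.ext h1) (Fin.ext h2)]

/-- Swapping the rapidities at the levels `k, k+1`. [folklore] -/
def zswap {L : Type*} (z : ℕ → L) (k : ℕ) : ℕ → L :=
  fun n => if n = k then z (k + 1) else if n = k + 1 then z k else z n

/-- The swapped rapidities away from the two levels. [folklore] -/
theorem zswap_of_ne {L : Type*} (z : ℕ → L) {k n : ℕ} (h1 : n ≠ k) (h2 : n ≠ k + 1) :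
    zswap z k n = z n := by
  simp [zswap, h1, h2]

/-- The swapped rapidity at the lower level. [folklore] -/
@[simp] theorem zswap_self {L : Type*} (z : ℕ → L) (k : ℕ) : zswap z k k = z (k + 1) := by simp [zswap]

/-- The swapped rapidity at the upper level. [folklore] -/
@[simp] theorem zswap_succ {L : Type*} (z : ℕ → L) (k : ℕ) : zswap z k (k + 1) = z k := by
  simp [zswap]

/-- The row weight of an edge only depends on its top level. [folklore] -/
theorem ipRowWeight_eq_of_level (q w : K) (z : ℕ → K) (r : Fin 2) {e : Sym2 (Site 2)} {k : ℕ}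
    (hk : (edgeTopLevel e).toNat = k) :
    ipRowWeight q w z r e =
      if k % 2 = 1 then ipWtA q (if r = 0 then z k / w else (w * z k)⁻¹)
      else ipWtB q (if r = 0 then z k / w else (w * z k)⁻¹) := by
  unfold ipRowWeight; rw [hk]

/-- **The swapped weights agree with the original ones off the two levels.** [folklore] -/
theorem ipRowWeight_zswap_of_ne (q w : K) (z : ℕ → K) (r : Fin 2) (k : ℕ) {e : Sym2 (Site 2)}
    (h1 : (edgeTopLevel e).toNat ≠ k) (h2 : (edgeTopLevel e).toNat ≠ k + 1) :
    ipRowWeight q w (zswap z k) r e = ipRowWeight q w z r e := by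
  unfold ipRowWeight
  rw [zswap_of_ne z h1 h2]

/-- `q² + q + 1 = 0` forces `q³ = 1`. [folklore] -/
theorem cube_eq_one_of_quad {q : K} (hq : q ^ 2 + q + 1 = 0) : q ^ 3 = 1 := by
  linear_combination (q - 1) * hq

/-- **Swap-and-complement at the two levels** (`A + B = 1`): the swapped weight of the edge of top
level `k` is one minus the original weight of the edge of top level `k+1`, and vice versa.
[cite: IkhlefPonsaing2012, §3.1] -/
theorem ipRowWeight_zswap_level {q : K} (hq : q ^ 2 + q + 1 = 0) (w : K) (z : ℕ → K) (r : Fin 2) (k : ℕ)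
    {e e' : Sym2 (Site 2)} (he : (edgeTopLevel e).toNat = k) (he' : (edgeTopLevel e').toNat = k + 1)
    (hnd : qbr (q / (if r = 0 then z (k + 1) / w else (w * z (k + 1))⁻¹)) ≠ 0) :
    ipRowWeight q w (zswap z k) r e = 1 - ipRowWeight q w z r e' := by
  rw [ipRowWeight_eq_of_level q w (zswap z k) r he, ipRowWeight_eq_of_level q w z r he', zswap_self]
  have hAB := ipWtA_add_ipWtB hq hnd
  rcases Nat.mod_two_eq_zero_or_one k with hk | hk
  · have hk0 : ¬ (k % 2 = 1) := by omega
    have hk1 : (k + 1) % 2 = 1 := by omega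
    rw [if_neg hk0, if_pos hk1]
    linear_combination hAB
  · have hk1 : ¬ ((k + 1) % 2 = 1) := by omega
    rw [if_pos hk, if_neg hk1]
    linear_combination hAB

/-- The same, the other way round. [cite: IkhlefPonsaing2012, §3.1] -/
theorem ipRowWeight_zswap_level' {q : K} (hq : q ^ 2 + q + 1 = 0) (w : K) (z : ℕ → K) (r : Fin 2) (k : ℕ)
    {e e' : Sym2 (Site 2)} (he : (edgeTopLevel e).toNat = k) (he' : (edgeTopLevel e').toNat = k + 1)
    (hnd : qbr (q / (if r = 0 then z k / w else (w * z k)⁻¹)) ≠ 0) :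
    ipRowWeight q w (zswap z k) r e' = 1 - ipRowWeight q w z r e := by
  rw [ipRowWeight_eq_of_level q w (zswap z k) r he', ipRowWeight_eq_of_level q w z r he, zswap_succ]
  have hAB := ipWtA_add_ipWtB hq hnd
  rcases Nat.mod_two_eq_zero_or_one k with hk | hk
  · have hk0 : ¬ (k % 2 = 1) := by omega
    have hk1 : (k + 1) % 2 = 1 := by omega
    rw [if_pos hk1, if_neg hk0]
    linear_combination hAB
  · have hk1 : ¬ ((k + 1) % 2 = 1) := by omega
    rw [if_neg hk1, if_pos hk]
    linear_combination hAB

end Levels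

/-! ### From rows to the lumped double row -/

section Assemble

variable {K : Type*} [Field K]

/-- A pattern reached with nonzero weight is an update, hence valid. [folklore] -/
theorem isValid_of_ipTransferW_ne_zero {c : ℤ} {p : Sym2 (Site 2) → K} {P P' : ColPattern m}
    (h : ipTransferW m c p P P' ≠ 0) : IsValid (c + 1) P' := by
  obtain ⟨U, -, hU⟩ := Finset.exists_ne_zero_of_sum_ne_zero h
  by_cases hc : colUpdate m c P (edgeFn m c U) = P'
  · exact hc ▸ colUpdate_isValid c P _
  · exact absurd (if_neg hc) hU

/-- The two forms of the exchange identity used in the rows (`A + B = 1`): case I with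
`(p_L, p_R) = (A(a), B(b))`. [cite: IkhlefPonsaing2012, Lemma 3.2] -/
theorem ipWt_exchange_formI {q a b : K} (hq : q ^ 2 + q + 1 = 0) (ha : a ≠ 0) (hb : b ≠ 0)
    (hqa : qbr (q / a) ≠ 0) (hqb : qbr (q / b) ≠ 0) :
    qbr (q * b / a) * (ipWtA q a * ipWtB q b - (1 - ipWtA q a) * (1 - ipWtB q b)) +
      qbr (a / b) * (1 - ipWtA q a * ipWtB q b) = 0 := by
  have h := ipWt_exchange_identity (cube_eq_one_of_quad hq) ha hb hqa hqb
  have hAa := ipWtA_add_ipWtB hq hqa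
  have hBb := ipWtA_add_ipWtB hq hqb
  linear_combination h + (qbr (q * b / a) * (1 - ipWtB q b)) * hAa + (qbr (q * b / a) * ipWtB q a) * hBb

/-- Case II with `(p_L, p_R) = (B(a), A(b))`. [cite: IkhlefPonsaing2012, Lemma 3.2] -/
theorem ipWt_exchange_formII {q a b : K} (hq : q ^ 2 + q + 1 = 0) (ha : a ≠ 0) (hb : b ≠ 0)
    (hqa : qbr (q / a) ≠ 0) (hqb : qbr (q / b) ≠ 0) :
    qbr (q * b / a) * (ipWtB q a * ipWtA q b - (1 - ipWtB q a) * (1 - ipWtA q b)) -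
      qbr (a / b) * (1 - (1 - ipWtB q a) * (1 - ipWtA q b)) = 0 := by
  have h := ipWt_exchange_identity (cube_eq_one_of_quad hq) ha hb hqa hqb
  have hAa := ipWtA_add_ipWtB hq hqa
  have hBb := ipWtA_add_ipWtB hq hqb
  linear_combination -h + ((qbr (q * b / a) - qbr (a / b)) * ipWtB q b) * hAa +
    ((qbr (q * b / a) - qbr (a / b)) * (1 - ipWtB q a)) * hBb

/-- Reindexing a double fibre sum. [folklore] -/
theorem sum_filter_sum_filter_eq {S : Type*} [Fintype S] [DecidableEq S] (f : S → K) (φ ψ : S → S) (R : S) :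
    ∑ X ∈ Finset.univ.filter (fun X => φ X = R), ∑ Y ∈ Finset.univ.filter (fun Y => ψ Y = X), f Y =
      ∑ Y, if φ (ψ Y) = R then f Y else 0 := by
  rw [Finset.sum_comm' (t' := Finset.univ.filter fun Y => φ (ψ Y) = R) (s' := fun Y => {ψ Y})]
  · rw [Finset.sum_filter]
    refine Finset.sum_congr rfl fun Y _ => ?_
    split_ifs <;> simp
  · intro X Y
    simp only [Finset.mem_filter, Finset.mem_univ, true_and, Finset.mem_singleton]
    constructor
    · rintro ⟨h1, h2⟩; subst h2; exact ⟨rfl, h1⟩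
    · rintro ⟨rfl, h1⟩; exact ⟨h1, rfl⟩

/-- **From the unlumped two-row identity to the lumped transfer matrix.** [folklore] -/
theorem ipTwoLayerW_interlace_of_rows {p₀ p₁ p₀' p₁' : Sym2 (Site 2) → K} {g₀ g₂ : ColPattern m → ColPattern m}
    {α β : K} {Q : ColPattern m}
    (hg₂ : ∀ P' : ColPattern m, IsValid 2 P' → lump (g₂ (lump P')) = lump (g₂ P'))
    (hrows : ∀ P'' : ColPattern m,
      α * (∑ P₁, ipTransferW m 0 p₀ Q P₁ * ipTransferW m 1 p₁ P₁ P'') -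
        β * ∑ P' ∈ Finset.univ.filter (fun P' => g₂ P' = P''),
          ∑ P₁, ipTransferW m 0 p₀ Q P₁ * ipTransferW m 1 p₁ P₁ P' =
      α * (∑ P₁, ipTransferW m 0 p₀' Q P₁ * ipTransferW m 1 p₁' P₁ P'') -
        β * ∑ P₁, ipTransferW m 0 p₀' (g₀ Q) P₁ * ipTransferW m 1 p₁' P₁ P'')
    (Q'' : ColPattern m) :
    α * ipTwoLayerW m p₀ p₁ Q Q'' -
        β * ∑ Q' ∈ Finset.univ.filter (fun Q' => lump (g₂ Q') = Q''), ipTwoLayerW m p₀ p₁ Q Q' =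
      α * ipTwoLayerW m p₀' p₁' Q Q'' - β * ipTwoLayerW m p₀' p₁' (g₀ Q) Q'' := by
  -- the two-layer kernel as a sum over the unlumped output
  have hT : ∀ (f₀ f₁ : Sym2 (Site 2) → K) (P R : ColPattern m), ipTwoLayerW m f₀ f₁ P R =
      ∑ P'' ∈ Finset.univ.filter (fun P'' => lump P'' = R),
        ∑ P₁, ipTransferW m 0 f₀ P P₁ * ipTransferW m 1 f₁ P₁ P'' :=
    fun f₀ f₁ P R => by unfold ipTwoLayerW; rw [Finset.sum_comm]
  -- the middle term: `∑_{P'} [lump (g₂ P') = Q''] (AB)(Q, P')`, rearranged along the fibres of `lump`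
  set F : ColPattern m → K := fun P' => ∑ P₁, ipTransferW m 0 p₀ Q P₁ * ipTransferW m 1 p₁ P₁ P' with hF
  have hvalid : ∀ P', F P' ≠ 0 → IsValid 2 P' := by
    intro P' hP'
    obtain ⟨P₁, -, h⟩ := Finset.exists_ne_zero_of_sum_ne_zero hP'
    have h2 := isValid_of_ipTransferW_ne_zero (right_ne_zero_of_mul h)
    norm_num at h2
    exact h2
  have hmid : ∑ Q' ∈ Finset.univ.filter (fun Q' => lump (g₂ Q') = Q''), ipTwoLayerW m p₀ p₁ Q Q' =
      ∑ P'' ∈ Finset.univ.filter (fun P'' => lump P'' = Q''),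
        ∑ P' ∈ Finset.univ.filter (fun P' => g₂ P' = P''), F P' := by
    rw [Finset.sum_congr rfl fun Q' _ => hT p₀ p₁ Q Q',
      sum_filter_sum_filter_eq F (fun Q' => lump (g₂ Q')) lump Q'', sum_filter_sum_filter_eq F lump g₂ Q'']
    refine Finset.sum_congr rfl fun P' _ => ?_
    by_cases hP' : F P' = 0
    · simp [hP']
    · rw [hg₂ P' (hvalid P' hP')]
  rw [hmid, hT p₀ p₁ Q Q'', hT p₀' p₁' Q Q'', hT p₀' p₁' (g₀ Q) Q'', Finset.mul_sum, Finset.mul_sum,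
    Finset.mul_sum, Finset.mul_sum, ← Finset.sum_sub_distrib, ← Finset.sum_sub_distrib]
  exact Finset.sum_congr rfl fun P'' _ => hrows P''

end Assemble

/-! ### Lemma 3.2 for the double-row transfer matrix -/

section Main

variable {K : Type*} [Field K]

/-- **Ikhlef–Ponsaing's Lemma 3.2 (interlacing), odd level `i = 2j+1`, cluster language.** For the
double-row transfer matrix `t(w; z⃗) = ipTransferMatrixW m q w z` (kernel on column patterns, lumped
at the even column), generic parameters, and a valid input pattern `Q`:
`[q z_{i+1}/z_i] t_z(Q → Q'') - [z_i/z_{i+1}] Σ_{Q' : lump (e_i Q') = Q''} t_z(Q → Q')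
   = [q z_{i+1}/z_i] t_{s_i z}(Q → Q'') - [z_i/z_{i+1}] t_{s_i z}(e_i Q → Q'')`,
i.e. `Ř_i(z_i/z_{i+1}) t(z⃗) = t(s_i z⃗) Ř_i(z_i/z_{i+1})` with `Ř_i(x) = ([q/x] - [x] e_i)/[qx]` and
`e_{2j+1} = join_{j, j+1}` on the connectivity states. [cite: IkhlefPonsaing2012, Lemma 3.2] -/
theorem ipTransferMatrixW_interlace_odd {q w : K} (hq : q ^ 2 + q + 1 = 0) (hw : w ≠ 0) (z : ℕ → K)
    (j j1 : Fin (m + 1)) (hj1 : (j1 : ℕ) = j + 1)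
    (hz : z (2 * j + 1) ≠ 0) (hz' : z (2 * j + 2) ≠ 0)
    (h1 : qbr (q * w / z (2 * j + 1)) ≠ 0) (h2 : qbr (q * w / z (2 * j + 2)) ≠ 0)
    (h3 : qbr (q * w * z (2 * j + 1)) ≠ 0) (h4 : qbr (q * w * z (2 * j + 2)) ≠ 0)
    {Q : ColPattern m} (hQ : IsValid 0 Q) (Q'' : ColPattern m) :
    qbr (q * z (2 * j + 2) / z (2 * j + 1)) * ipTransferMatrixW m q w z Q Q'' -
        qbr (z (2 * j + 1) / z (2 * j + 2)) *
          ∑ Q' ∈ Finset.univ.filter (fun Q' => lump (cpJoin j j1 Q') = Q''), ipTransferMatrixW m q w z Q Q' =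
      qbr (q * z (2 * j + 2) / z (2 * j + 1)) * ipTransferMatrixW m q w (zswap z (2 * j + 1)) Q Q'' -
        qbr (z (2 * j + 1) / z (2 * j + 2)) *
          ipTransferMatrixW m q w (zswap z (2 * j + 1)) (cpJoin j j1 Q) Q'' := by
  -- name the level and normalise `2j+2 = i+1`
  obtain ⟨i, hi⟩ : ∃ i : ℕ, i = 2 * (j : ℕ) + 1 := ⟨_, rfl⟩
  have hi1 : 2 * (j : ℕ) + 2 = i + 1 := by omega
  rw [hi1] at hz' h2 h4 ⊢
  rw [← hi] at hz h1 h3 ⊢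
  have hne : j ≠ j1 := fun h => by have := congrArg Fin.val h; omega
  simp only [ipTransferMatrixW_eq]
  refine ipTwoLayerW_interlace_of_rows (g₂ := cpJoin j j1)
    (fun P' hP' => lump_cpJoin_lump j j1 hP'.symm) (fun P'' => ?_) Q''
  refine interlace_compose (V₁ := IsValid 1) (g₁ := cpIsolate j)
    (fun P₁ h => by have h' := isValid_of_ipTransferW_ne_zero h; norm_num at h'; exact h')
    (fun P'' => ?_) (fun P₁ hP₁ P'' => ?_) P''
  · ---------------- row 0: bridge at the new site `j` of column 1 (level `i`)
    have hL : s(colSite 0 (j : ℕ), colSite (0 + 1) (j : ℕ)) ∈ latticeLayer m 0 :=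
      (mk_mem_latticeLayer_iff 0 j j).2 (Or.inl rfl)
    have hR : s(colSite 0 (j1 : ℕ), colSite (0 + 1) (j : ℕ)) ∈ latticeLayer m 0 :=
      (mk_mem_latticeLayer_iff 0 j1 j).2 (Or.inr (by omega))
    have honly : ∀ i' : Fin (m + 1), s(colSite 0 (i' : ℕ), colSite (0 + 1) (j : ℕ)) ∈ latticeLayer m 0 →
        i' = j ∨ i' = j1 := fun i' hi' => by
      rcases (mk_mem_latticeLayer_iff 0 i' j).1 hi' with h | h
      · exact Or.inl (Fin.ext (by omega))
      · exact Or.inr (Fin.ext (by omega))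
    have hWj : ¬ ((0 + 1 : ℤ) % 2 = 0 ∧ (j : ℕ) = 0) := by omega
    have heL : (edgeTopLevel s(colSite 0 (j : ℕ), colSite (0 + 1) (j : ℕ))).toNat = i := by
      rw [edgeTopLevel_mk_colSite]; omega
    have heR : (edgeTopLevel s(colSite 0 (j1 : ℕ), colSite (0 + 1) (j : ℕ))).toNat = i + 1 := by
      rw [edgeTopLevel_mk_colSite]; omega
    have hpp' : ∀ e ∈ latticeLayer m 0, e ≠ s(colSite 0 (j : ℕ), colSite (0 + 1) (j : ℕ)) →
        e ≠ s(colSite 0 (j1 : ℕ), colSite (0 + 1) (j : ℕ)) →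
        ipRowWeight q w (zswap z i) 0 e = ipRowWeight q w z 0 e := fun e he hne1 hne2 =>
      ipRowWeight_zswap_of_ne q w z 0 i
        (fun h => hne1 (eq_of_edgeTopLevel_eq he hL (by omega)))
        (fun h => hne2 (eq_of_edgeTopLevel_eq he hR (by omega)))
    have hL' := ipRowWeight_zswap_level hq w z 0 i heL heR (by rw [if_pos rfl, div_div_eq_mul_div]; exact h2)
    have hR' := ipRowWeight_zswap_level' hq w z 0 i heL heR (by rw [if_pos rfl, div_div_eq_mul_div]; exact h1)
    have hpL : ipRowWeight q w z 0 s(colSite 0 (j : ℕ), colSite (0 + 1) (j : ℕ)) = ipWtA q (z i / w) := by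
      rw [ipRowWeight_eq_of_level q w z 0 heL, if_pos (by omega), if_pos rfl]
    have hpR : ipRowWeight q w z 0 s(colSite 0 (j1 : ℕ), colSite (0 + 1) (j : ℕ)) = ipWtB q (z (i + 1) / w) := by
      rw [ipRowWeight_eq_of_level q w z 0 heR, if_neg (by omega), if_pos rfl]
    have hform := ipWt_exchange_formI hq (div_ne_zero hz hw) (div_ne_zero hz' hw)
      (by rw [div_div_eq_mul_div]; exact h1) (by rw [div_div_eq_mul_div]; exact h2)
    have e1 : q * (z (i + 1) / w) / (z i / w) = q * z (i + 1) / z i := by field_simp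
    have e2 : z i / w / (z (i + 1) / w) = z i / z (i + 1) := by field_simp
    rw [e1, e2, ← hpL, ← hpR] at hform
    have hrow := ipTransferW_interlace_bridge hne hL hR honly hWj hQ.refl hpp' hL' hR' hform P''
    linear_combination hrow
  · ---------------- row 1: fork at the old site `j` of column 1 (level `i`)
    have hL : s(colSite 1 (j : ℕ), colSite (1 + 1) (j : ℕ)) ∈ latticeLayer m 1 :=
      (mk_mem_latticeLayer_iff 1 j j).2 (Or.inl rfl)
    have hR : s(colSite 1 (j : ℕ), colSite (1 + 1) (j1 : ℕ)) ∈ latticeLayer m 1 :=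
      (mk_mem_latticeLayer_iff 1 j j1).2 (Or.inr (by omega))
    have honly : ∀ j' : Fin (m + 1), s(colSite 1 (j : ℕ), colSite (1 + 1) (j' : ℕ)) ∈ latticeLayer m 1 →
        j' = j ∨ j' = j1 := fun j' hj' => by
      rcases (mk_mem_latticeLayer_iff 1 j j').1 hj' with h | h
      · exact Or.inl (Fin.ext (by omega))
      · exact Or.inr (Fin.ext (by omega))
    have heL : (edgeTopLevel s(colSite 1 (j : ℕ), colSite (1 + 1) (j : ℕ))).toNat = i := by
      rw [edgeTopLevel_mk_colSite]; omega
    have heR : (edgeTopLevel s(colSite 1 (j : ℕ), colSite (1 + 1) (j1 : ℕ))).toNat = i + 1 := by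
      rw [edgeTopLevel_mk_colSite]; omega
    have hpp' : ∀ e ∈ latticeLayer m 1, e ≠ s(colSite 1 (j : ℕ), colSite (1 + 1) (j : ℕ)) →
        e ≠ s(colSite 1 (j : ℕ), colSite (1 + 1) (j1 : ℕ)) →
        ipRowWeight q w (zswap z i) 1 e = ipRowWeight q w z 1 e := fun e he hne1 hne2 =>
      ipRowWeight_zswap_of_ne q w z 1 i
        (fun h => hne1 (eq_of_edgeTopLevel_eq he hL (by omega)))
        (fun h => hne2 (eq_of_edgeTopLevel_eq he hR (by omega)))
    have h10 : (1 : Fin 2) ≠ 0 := by decide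
    have hL' := ipRowWeight_zswap_level hq w z 1 i heL heR
      (by rw [if_neg h10, div_inv_eq_mul, ← mul_assoc]; exact h4)
    have hR' := ipRowWeight_zswap_level' hq w z 1 i heL heR
      (by rw [if_neg h10, div_inv_eq_mul, ← mul_assoc]; exact h3)
    have hpL : ipRowWeight q w z 1 s(colSite 1 (j : ℕ), colSite (1 + 1) (j : ℕ)) = ipWtA q (w * z i)⁻¹ := by
      rw [ipRowWeight_eq_of_level q w z 1 heL, if_pos (by omega), if_neg h10]
    have hpR : ipRowWeight q w z 1 s(colSite 1 (j : ℕ), colSite (1 + 1) (j1 : ℕ)) = ipWtB q (w * z (i + 1))⁻¹ := by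
      rw [ipRowWeight_eq_of_level q w z 1 heR, if_neg (by omega), if_neg h10]
    have hform := ipWt_exchange_formII hq (a := (w * z (i + 1))⁻¹) (b := (w * z i)⁻¹)
      (inv_ne_zero (mul_ne_zero hw hz')) (inv_ne_zero (mul_ne_zero hw hz))
      (by rw [div_inv_eq_mul, ← mul_assoc]; exact h4) (by rw [div_inv_eq_mul, ← mul_assoc]; exact h3)
    have e1 : q * (w * z i)⁻¹ / (w * z (i + 1))⁻¹ = q * z (i + 1) / z i := by field_simp
    have e2 : (w * z (i + 1))⁻¹ / (w * z i)⁻¹ = z i / z (i + 1) := by field_simp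
    rw [e1, e2, ← hpL, ← hpR] at hform
    have hrow := ipTransferW_interlace_fork (α := qbr (q * z (i + 1) / z i)) (β := qbr (z i / z (i + 1)))
      hne hL hR honly hP₁ hpp' hL' hR' (by linear_combination hform) P''
    linear_combination hrow

/-- **Ikhlef–Ponsaing's Lemma 3.2 (interlacing), even level `i = 2b`** (`1 ≤ b ≤ m`), with
`e_{2b} = iso_b` on the connectivity states. [cite: IkhlefPonsaing2012, Lemma 3.2] -/
theorem ipTransferMatrixW_interlace_even {q w : K} (hq : q ^ 2 + q + 1 = 0) (hw : w ≠ 0) (z : ℕ → K)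
    (b0 b : Fin (m + 1)) (hb0 : (b : ℕ) = b0 + 1)
    (hz : z (2 * b) ≠ 0) (hz' : z (2 * b + 1) ≠ 0)
    (h1 : qbr (q * w / z (2 * b)) ≠ 0) (h2 : qbr (q * w / z (2 * b + 1)) ≠ 0)
    (h3 : qbr (q * w * z (2 * b)) ≠ 0) (h4 : qbr (q * w * z (2 * b + 1)) ≠ 0)
    {Q : ColPattern m} (hQ : IsValid 0 Q) (Q'' : ColPattern m) :
    qbr (q * z (2 * b + 1) / z (2 * b)) * ipTransferMatrixW m q w z Q Q'' -
        qbr (z (2 * b) / z (2 * b + 1)) *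
          ∑ Q' ∈ Finset.univ.filter (fun Q' => lump (cpIsolate b Q') = Q''), ipTransferMatrixW m q w z Q Q' =
      qbr (q * z (2 * b + 1) / z (2 * b)) * ipTransferMatrixW m q w (zswap z (2 * b)) Q Q'' -
        qbr (z (2 * b) / z (2 * b + 1)) *
          ipTransferMatrixW m q w (zswap z (2 * b)) (cpIsolate b Q) Q'' := by
  -- name the level
  obtain ⟨i, hi⟩ : ∃ i : ℕ, i = 2 * (b : ℕ) := ⟨_, rfl⟩
  rw [← hi] at hz hz' h1 h2 h3 h4 ⊢
  have hne : b0 ≠ b := fun h => by have := congrArg Fin.val h; omega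
  simp only [ipTransferMatrixW_eq]
  refine ipTwoLayerW_interlace_of_rows (g₂ := cpIsolate b)
    (fun P' _ => by rw [← lump_cpIsolate, lump_lump]) (fun P'' => ?_) Q''
  refine interlace_compose (V₁ := IsValid 1) (g₁ := cpJoin b0 b)
    (fun P₁ h => by have h' := isValid_of_ipTransferW_ne_zero h; norm_num at h'; exact h')
    (fun P'' => ?_) (fun P₁ hP₁ P'' => ?_) P''
  · ---------------- row 0: fork at the old site `b` of column 0 (level `i`)
    have hL : s(colSite 0 (b : ℕ), colSite (0 + 1) (b0 : ℕ)) ∈ latticeLayer m 0 :=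
      (mk_mem_latticeLayer_iff 0 b b0).2 (Or.inr (by omega))
    have hR : s(colSite 0 (b : ℕ), colSite (0 + 1) (b : ℕ)) ∈ latticeLayer m 0 :=
      (mk_mem_latticeLayer_iff 0 b b).2 (Or.inl rfl)
    have honly : ∀ j' : Fin (m + 1), s(colSite 0 (b : ℕ), colSite (0 + 1) (j' : ℕ)) ∈ latticeLayer m 0 →
        j' = b0 ∨ j' = b := fun j' hj' => by
      rcases (mk_mem_latticeLayer_iff 0 b j').1 hj' with h | h
      · exact Or.inr (Fin.ext (by omega))
      · exact Or.inl (Fin.ext (by omega))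
    have heL : (edgeTopLevel s(colSite 0 (b : ℕ), colSite (0 + 1) (b0 : ℕ))).toNat = i := by
      rw [edgeTopLevel_mk_colSite]; omega
    have heR : (edgeTopLevel s(colSite 0 (b : ℕ), colSite (0 + 1) (b : ℕ))).toNat = i + 1 := by
      rw [edgeTopLevel_mk_colSite]; omega
    have hpp' : ∀ e ∈ latticeLayer m 0, e ≠ s(colSite 0 (b : ℕ), colSite (0 + 1) (b0 : ℕ)) →
        e ≠ s(colSite 0 (b : ℕ), colSite (0 + 1) (b : ℕ)) →
        ipRowWeight q w (zswap z i) 0 e = ipRowWeight q w z 0 e := fun e he hne1 hne2 =>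
      ipRowWeight_zswap_of_ne q w z 0 i
        (fun h => hne1 (eq_of_edgeTopLevel_eq he hL (by omega)))
        (fun h => hne2 (eq_of_edgeTopLevel_eq he hR (by omega)))
    have hL' := ipRowWeight_zswap_level hq w z 0 i heL heR (by rw [if_pos rfl, div_div_eq_mul_div]; exact h2)
    have hR' := ipRowWeight_zswap_level' hq w z 0 i heL heR (by rw [if_pos rfl, div_div_eq_mul_div]; exact h1)
    have hpL : ipRowWeight q w z 0 s(colSite 0 (b : ℕ), colSite (0 + 1) (b0 : ℕ)) = ipWtB q (z i / w) := by
      rw [ipRowWeight_eq_of_level q w z 0 heL, if_neg (by omega), if_pos rfl]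
    have hpR : ipRowWeight q w z 0 s(colSite 0 (b : ℕ), colSite (0 + 1) (b : ℕ)) = ipWtA q (z (i + 1) / w) := by
      rw [ipRowWeight_eq_of_level q w z 0 heR, if_pos (by omega), if_pos rfl]
    have hform := ipWt_exchange_formII hq (div_ne_zero hz hw) (div_ne_zero hz' hw)
      (by rw [div_div_eq_mul_div]; exact h1) (by rw [div_div_eq_mul_div]; exact h2)
    have e1 : q * (z (i + 1) / w) / (z i / w) = q * z (i + 1) / z i := by field_simp
    have e2 : z i / w / (z (i + 1) / w) = z i / z (i + 1) := by field_simp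
    rw [e1, e2, ← hpL, ← hpR] at hform
    have hrow := ipTransferW_interlace_fork (α := qbr (q * z (i + 1) / z i)) (β := qbr (z i / z (i + 1)))
      hne hL hR honly hQ hpp' hL' hR' (by linear_combination hform) P''
    linear_combination hrow
  · ---------------- row 1: bridge at the new site `b` of column 2 (level `i`)
    have hL : s(colSite 1 (b0 : ℕ), colSite (1 + 1) (b : ℕ)) ∈ latticeLayer m 1 :=
      (mk_mem_latticeLayer_iff 1 b0 b).2 (Or.inr (by omega))
    have hR : s(colSite 1 (b : ℕ), colSite (1 + 1) (b : ℕ)) ∈ latticeLayer m 1 :=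
      (mk_mem_latticeLayer_iff 1 b b).2 (Or.inl rfl)
    have honly : ∀ i' : Fin (m + 1), s(colSite 1 (i' : ℕ), colSite (1 + 1) (b : ℕ)) ∈ latticeLayer m 1 →
        i' = b0 ∨ i' = b := fun i' hi' => by
      rcases (mk_mem_latticeLayer_iff 1 i' b).1 hi' with h | h
      · exact Or.inr (Fin.ext (by omega))
      · exact Or.inl (Fin.ext (by omega))
    have hWj : ¬ ((1 + 1 : ℤ) % 2 = 0 ∧ (b : ℕ) = 0) := by omega
    have heL : (edgeTopLevel s(colSite 1 (b0 : ℕ), colSite (1 + 1) (b : ℕ))).toNat = i := by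
      rw [edgeTopLevel_mk_colSite]; omega
    have heR : (edgeTopLevel s(colSite 1 (b : ℕ), colSite (1 + 1) (b : ℕ))).toNat = i + 1 := by
      rw [edgeTopLevel_mk_colSite]; omega
    have hpp' : ∀ e ∈ latticeLayer m 1, e ≠ s(colSite 1 (b0 : ℕ), colSite (1 + 1) (b : ℕ)) →
        e ≠ s(colSite 1 (b : ℕ), colSite (1 + 1) (b : ℕ)) →
        ipRowWeight q w (zswap z i) 1 e = ipRowWeight q w z 1 e := fun e he hne1 hne2 =>
      ipRowWeight_zswap_of_ne q w z 1 i
        (fun h => hne1 (eq_of_edgeTopLevel_eq he hL (by omega)))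
        (fun h => hne2 (eq_of_edgeTopLevel_eq he hR (by omega)))
    have h10 : (1 : Fin 2) ≠ 0 := by decide
    have hL' := ipRowWeight_zswap_level hq w z 1 i heL heR
      (by rw [if_neg h10, div_inv_eq_mul, ← mul_assoc]; exact h4)
    have hR' := ipRowWeight_zswap_level' hq w z 1 i heL heR
      (by rw [if_neg h10, div_inv_eq_mul, ← mul_assoc]; exact h3)
    have hpL : ipRowWeight q w z 1 s(colSite 1 (b0 : ℕ), colSite (1 + 1) (b : ℕ)) = ipWtB q (w * z i)⁻¹ := by
      rw [ipRowWeight_eq_of_level q w z 1 heL, if_neg (by omega), if_neg h10]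
    have hpR : ipRowWeight q w z 1 s(colSite 1 (b : ℕ), colSite (1 + 1) (b : ℕ)) = ipWtA q (w * z (i + 1))⁻¹ := by
      rw [ipRowWeight_eq_of_level q w z 1 heR, if_pos (by omega), if_neg h10]
    have hform := ipWt_exchange_formI hq (a := (w * z (i + 1))⁻¹) (b := (w * z i)⁻¹)
      (inv_ne_zero (mul_ne_zero hw hz')) (inv_ne_zero (mul_ne_zero hw hz))
      (by rw [div_inv_eq_mul, ← mul_assoc]; exact h4) (by rw [div_inv_eq_mul, ← mul_assoc]; exact h3)
    have e1 : q * (w * z i)⁻¹ / (w * z (i + 1))⁻¹ = q * z (i + 1) / z i := by field_simp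
    have e2 : (w * z (i + 1))⁻¹ / (w * z i)⁻¹ = z i / z (i + 1) := by field_simp
    rw [e1, e2, ← hpL, ← hpR] at hform
    have hrow := ipTransferW_interlace_bridge (α := qbr (q * z (i + 1) / z i)) (β := qbr (z i / z (i + 1)))
      hne hL hR honly hWj hP₁.refl hpp' hL' hR' (by linear_combination hform) P''
    linear_combination hrow

end Main

end Literature.Probability.Percolation
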